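import Summits.CriticalPhenomena.CardyFormulaZ2.Theorems.CardySelfRefinementLagHandOffNoIdleAuxGrid
import Literature.Probability.Percolation.HalfSpaceBrickSeeds
import Literature.Probability.Percolation.AnnulusCrossingBoundProofs
import Literature.Probability.Percolation.InterfaceCurves
import Literature.Probability.LatticeModels.DobrushinDiscretisation
import HarnessLib

/-!
# No sliding of the limit interface, part 1: a chain of visited bulk points costs a product of
one-arm probabilities

Helper file for the registered stub `stub_quadTransfer_noSliding` of line `hitting-tournament`
of crux `LagHandOff` (stmt-CriticalPhenomena-10268), namespace
`Summit.CriticalPhenomena.CardyFormulaZ2.Cruxes.LagHandOff.HittingTournament`.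

DISCRETE INPUT (deterministic, every configuration, general admissible data `D'` on a Jordan
domain `D`): if the exploration polygon comes within `ρ'` of a point `x` at one time and is at
distance `≥ R` from `x` at another time (in either order), and `x` is at distance
`≥ 2(R + 6δ)` from `∂D`, then between the two times it traverses the shell `D(x; ρ', R)`
(`exists_isTraversal_of_near_far`, two-sided form of the tree's `exists_isTraversal_of_visit`)
with all left vertices off the discrete arc `A` (all discrete boundary sites are within `2δ`
of `∂D`, `le_dist_meshPoint_of_mem_zdBoundary`), hence `ω` itself has an open arm across
`A(x; ρ' + δ, R - δ)` (`arm_of_near_far`, by `mem_annulusOpenCrossing_of_traversal`).  So if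
the polygon passes within `ρ` of each of the points `z 0, …, z N`, consecutive ones `≥ 40ρ`
apart and all at distance `≥ 44ρ` from `∂D`, then `ω` has open arms across the `N` annuli
`A(z j; ρ + δ, 16ρ - δ)`, `j < N` (`arms_of_visits`).

PROBABILITY: these annulus events are determined by the edges among sites within `16ρ + δ`
of their centres, pairwise disjoint sets once the centres are `40ρ`-separated
(`pairwiseDisjoint_sym2_of_sep`), so by independence (`bondPercolation_real_biInter_eq_prod`)
and the RSW one-arm bound `(r/R)^α` (hypothesis; discharged in the tree by
`annulusOpenCrossing_half_le_holds`) the joint probability is `≤ (4^{-α})^N`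
(`real_biInter_annulusOpenCrossing_le`); a union bound over a finite family of candidate
chains (`real_setOf_visits_le`) and the passage to the interface class of a discretisation
family (`eventually_measure_preimage_visits_le`, registered sub-stub
`stub_noSliding_visitsBound`) finish the estimate.

References: M. Aizenman, A. Burchard, Duke Math. J. 99 (1999), App. A (arms bordering shell
traversals; straight runs have dimension > 1 cost); G. Grimmett, *Percolation* (1999), §11.7–11.8
(RSW, one-arm decay at `p = 1/2`), §2.2 (independence of disjoint edge sets).
-/

noncomputable section

open MeasureTheory Filter Set Topology Metric
open scoped unitInterval
open Literature.Probability.Percolation Literature.Probability.LatticeModels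
open Literature.Probability.RandomPlanarGeometry

namespace Summit.CriticalPhenomena.CardyFormulaZ2.Cruxes.LagHandOff.HittingTournament

/-! ### A near time and a far time give a traversal, hence an arm -/

/-- **Tight traversals, two-sided.** If a continuous curve is within `ρ'` of `z` at one time
and at distance `≥ R > ρ'` from `z` at another time (in either order), some segment of it
traverses the shell `D(z; ρ', R)` while staying in `B̄(z, R)`. -/
theorem exists_isTraversal_of_near_far (c : C(I, ℂ)) {z : ℂ} {ρ' R : ℝ} (hρ'R : ρ' < R)
    {u₁ u₂ : I} (hu₁ : dist (c u₁) z ≤ ρ') (hu₂ : R ≤ dist (c u₂) z) :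
    ∃ s t : I, (⟨c⟩ : Curve ℂ).IsTraversal z ρ' R s t ∧
      ∀ u, s ≤ u → u ≤ t → dist (c u) z ≤ R := by
  have hf : Continuous fun u => dist (c u) z := c.continuous.dist continuous_const
  rcases le_total u₁ u₂ with h | h
  · obtain ⟨s, t, -, hst, -, hs, ht, hbetween⟩ :=
      exists_tight_crossing (f := fun u => dist (c u) z) hf h hρ'R hu₁ hu₂
    exact ⟨s, t, ⟨hst.le, Or.inl ⟨hs.le, ht.ge⟩⟩, fun u hsu hut => (hbetween u hsu hut).2⟩
  · obtain ⟨s, t, -, hst, -, hs, ht, hbetween⟩ :=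
      exists_tight_crossing' (f := fun u => dist (c u) z) hf h hρ'R hu₂ hu₁
    exact ⟨s, t, ⟨hst.le, Or.inr ⟨hs.ge, ht.le⟩⟩, fun u hsu hut => (hbetween u hsu hut).2⟩

/-- **A near time and a far time at a bulk point force an open arm of `ω` itself.** For
admissible data `D'` on the Jordan domain `D` and a point `x` at distance `≥ 2(R + 6δ)` from
`∂D`: if the exploration polygon of `ω` is within `ρ' < R` of `x` at one time and at distance
`≥ R` at another, then `ω` contains an open crossing of `A(x; ρ' + δ, R - δ)` (the left chain
of the traversed darts avoids the discrete arc `A`, whose sites are within `2δ` of `∂D`). -/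
theorem arm_of_near_far {D' : DiscreteDobrushin} (hadm : D'.IsZdAdmissible) (Dm : DobrushinDomain)
    (hΩ : D'.Ω = Dm.carrier) {x : ℂ} {ρ' R : ℝ} (hρ'R : ρ' < R)
    (hfr : 2 * (R + 6 * D'.δ) ≤ infDist x (frontier Dm.carrier)) {ω : BondConfig (Site 2)}
    {u₁ u₂ : I} (hu₁ : dist (medialExplorationCurve D' ω u₁) x ≤ ρ')
    (hu₂ : R ≤ dist (medialExplorationCurve D' ω u₂) x) :
    ω ∈ annulusOpenCrossing x D'.δ (ρ' + D'.δ) (R - D'.δ) := by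
  have hδ : 0 < D'.δ := hadm.delta_pos
  have hR : 0 < R := (dist_nonneg.trans hu₁).trans_lt hρ'R
  have hγ := isMedialExploration_medialExploration_holds D' hadm ω
  obtain ⟨a, l, hal⟩ := List.exists_cons_of_ne_nil hγ.ne_nil
  rw [hal] at hγ
  have hcurve_eq : medialExplorationCurve D' ω = polyline ((a :: l).map (medialPoint D'.δ)) := by
    rw [medialExplorationCurve, hal]
  rw [hcurve_eq] at hu₁ hu₂
  obtain ⟨s, t, htr, hin⟩ :=
    exists_isTraversal_of_near_far (polyline ((a :: l).map (medialPoint D'.δ))) hρ'R hu₁ hu₂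
  have hfar := (forall_corner_not_mem_of_far hγ hδ.le htr.1 hin (S := D'.zdArcA)
    fun v hv => by
      have := le_dist_meshPoint_of_mem_zdBoundary Dm hΩ hδ hfr (by linarith)
        (D'.zdArcA_subset_zdBoundary hv)
      linarith).1
  exact mem_annulusOpenCrossing_of_traversal hγ hδ hρ'R.le htr fun i h0 h1 => hfar i h0.le h1

/-- **A chain of visited bulk points forces open arms in all the annuli of the chain.** If
the exploration polygon (admissible data on `D`, mesh `δ ≤ ρ`) passes within `ρ` of each of
the points `z 0, …, z N`, where `dist (z (j+1)) (z j) ≥ 40ρ` and every `z j` is at distance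
`≥ 44ρ` from `∂D`, then `ω` has an open crossing of `A(z j; ρ + δ, 16ρ - δ)` for every `j < N`
(the visit near `z (j+1)` is the far time for `z j`). -/
theorem arms_of_visits {D' : DiscreteDobrushin} (hadm : D'.IsZdAdmissible) (Dm : DobrushinDomain)
    (hΩ : D'.Ω = Dm.carrier) {ρ : ℝ} (hδρ : D'.δ ≤ ρ) {z : ℕ → ℂ} {N : ℕ}
    (hsep : ∀ j < N, 40 * ρ ≤ dist (z (j + 1)) (z j))
    (hfr : ∀ j ≤ N, 44 * ρ ≤ infDist (z j) (frontier Dm.carrier)) {ω : BondConfig (Site 2)}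
    (hvis : ∀ j ≤ N, ∃ u, dist (medialExplorationCurve D' ω u) (z j) < ρ) :
    ∀ j < N, ω ∈ annulusOpenCrossing (z j) D'.δ (ρ + D'.δ) (16 * ρ - D'.δ) := by
  intro j hj
  have hδ : 0 < D'.δ := hadm.delta_pos
  obtain ⟨u₁, hu₁⟩ := hvis j hj.le
  obtain ⟨u₂, hu₂⟩ := hvis (j + 1) hj
  have hfar : 16 * ρ ≤ dist (medialExplorationCurve D' ω u₂) (z j) := by
    have h1 := hsep j hj
    rw [dist_comm] at hu₂
    linarith [dist_triangle (z (j + 1)) (medialExplorationCurve D' ω u₂) (z j)]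
  refine arm_of_near_far hadm Dm hΩ (by linarith : ρ < 16 * ρ) ?_ hu₁.le hfar
  have := hfr j hj.le
  linarith

/-! ### Independence of the annulus events of a separated chain -/

/-- The edge supports of the annulus events `A(z j; ·, 16ρ - δ)` of `40ρ`-separated centres are
pairwise disjoint (a common edge would have an endpoint within `16ρ + δ` of two centres
`≥ 40ρ` apart). -/
theorem pairwiseDisjoint_sym2_of_sep {δ ρ : ℝ} (hδ : 0 < δ) (hδρ : δ ≤ ρ) {z : ℕ → ℂ}
    (hsep : ∀ i j, i ≠ j → 40 * ρ ≤ dist (z i) (z j)) (s : Set ℕ) :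
    s.PairwiseDisjoint fun j =>
      (↑(finite_setOf_dist_meshPoint_le hδ (z j) (16 * ρ - δ + 2 * δ)).toFinset.sym2 :
        Set (Sym2 (Site 2))) := by
  intro i _ j _ hij
  refine Set.disjoint_left.2 fun e hei hej => ?_
  rw [Finset.mem_coe, Finset.mem_sym2_iff] at hei hej
  have hv := Sym2.out_fst_mem e
  have h1 := hei _ hv
  have h2 := hej _ hv
  rw [Set.Finite.mem_toFinset, mem_setOf_eq] at h1 h2
  have := hsep i j hij
  linarith [dist_triangle (z i) (meshPoint δ e.out.1) (z j), dist_comm (z i) (meshPoint δ e.out.1)]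

/-- **The annulus events of a separated chain cost a product of one-arm probabilities.** Under
the RSW one-arm bound `P(A(x; r, R) crossed by an open path) ≤ (r/R)^α` (`c₀δ ≤ r`, `2r ≤ R`),
for `40ρ`-separated centres `z j`, mesh `δ ≤ ρ` with `c₀δ ≤ ρ`, the probability that all the
annuli `A(z j; ρ + δ, 16ρ - δ)`, `j < N`, are crossed by open paths is at most `(4^{-α})^N`
(independence of events determined by disjoint edge sets). -/
theorem real_biInter_annulusOpenCrossing_le {α c₀ : ℝ} (hα : 0 < α)
    (hRSW : ∀ (x : ℂ) (δ r R : ℝ), 0 < δ → c₀ * δ ≤ r → 2 * r ≤ R →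
      (bondPercolation (zdGraph 2) half).real (annulusOpenCrossing x δ r R) ≤ (r / R) ^ α)
    {δ ρ : ℝ} (hδ : 0 < δ) (hδρ : δ ≤ ρ) (hc₀ : c₀ * δ ≤ ρ) {z : ℕ → ℂ}
    (hsep : ∀ i j, i ≠ j → 40 * ρ ≤ dist (z i) (z j)) (N : ℕ) :
    (bondPercolation (zdGraph 2) half).real
        (⋂ j ∈ Finset.range N, annulusOpenCrossing (z j) δ (ρ + δ) (16 * ρ - δ)) ≤
      ((1 / 4 : ℝ) ^ α) ^ N := by
  rw [bondPercolation_real_biInter_eq_prod (zdGraph 2) half (Finset.range N)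
    (fun j => annulusOpenCrossing (z j) δ (ρ + δ) (16 * ρ - δ))
    (fun j => (↑(finite_setOf_dist_meshPoint_le hδ (z j) (16 * ρ - δ + 2 * δ)).toFinset.sym2 :
      Set (Sym2 (Site 2))))
    (fun j _ => determinedBy_annulusOpenCrossing hδ (z j) _ _)
    (fun j _ => measurableSet_annulusOpenCrossing hδ (z j) _ _)
    (pairwiseDisjoint_sym2_of_sep hδ hδρ hsep _)]
  calc ∏ j ∈ Finset.range N,
        (bondPercolation (zdGraph 2) half).real (annulusOpenCrossing (z j) δ (ρ + δ) (16 * ρ - δ))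
      ≤ ∏ _j ∈ Finset.range N, (1 / 4 : ℝ) ^ α := by
        refine Finset.prod_le_prod (fun j _ => measureReal_nonneg) fun j _ => ?_
        refine (hRSW (z j) δ (ρ + δ) (16 * ρ - δ) hδ (by linarith) (by linarith)).trans ?_
        refine Real.rpow_le_rpow (div_nonneg (by linarith) (by linarith)) ?_ hα.le
        rw [div_le_div_iff₀ (by linarith) (by norm_num : (0 : ℝ) < 4)]
        linarith
    _ = ((1 / 4 : ℝ) ^ α) ^ N := by rw [Finset.prod_const, Finset.card_range]

/-! ### The union bound over a finite family of chains, and the family form -/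

/-- **Union bound over candidate chains, at a fixed mesh.** For admissible data `D'` on `D`
(mesh `δ ≤ ρ`, `c₀δ ≤ ρ`) and finitely many chains `z i`, `i ∈ s`, of pairwise
`40ρ`-separated points: the probability that for SOME chain all of whose points `z i j`,
`j ≤ N`, are at distance `≥ 44ρ` from `∂D`, the exploration polygon passes within `ρ` of every
`z i j`, `j ≤ N`, is at most `|s| (4^{-α})^N`. -/
theorem real_setOf_visits_le {ι : Type*} {D' : DiscreteDobrushin} (hadm : D'.IsZdAdmissible)
    (Dm : DobrushinDomain) (hΩ : D'.Ω = Dm.carrier) {α c₀ : ℝ} (hα : 0 < α)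
    (hRSW : ∀ (x : ℂ) (δ r R : ℝ), 0 < δ → c₀ * δ ≤ r → 2 * r ≤ R →
      (bondPercolation (zdGraph 2) half).real (annulusOpenCrossing x δ r R) ≤ (r / R) ^ α)
    {ρ : ℝ} (hδρ : D'.δ ≤ ρ) (hc₀ : c₀ * D'.δ ≤ ρ) (s : Finset ι) {z : ι → ℕ → ℂ}
    (hsep : ∀ i ∈ s, ∀ j j', j ≠ j' → 40 * ρ ≤ dist (z i j) (z i j')) (N : ℕ) :
    (bondPercolation (zdGraph 2) half).real {ω | ∃ i ∈ s,
        (∀ j ≤ N, 44 * ρ ≤ infDist (z i j) (frontier Dm.carrier)) ∧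
          ∀ j ≤ N, ∃ u, dist (medialExplorationCurve D' ω u) (z i j) < ρ} ≤
      s.card * ((1 / 4 : ℝ) ^ α) ^ N := by
  have hδ : 0 < D'.δ := hadm.delta_pos
  set B : ι → Set (BondConfig (Site 2)) := fun i =>
    ⋂ j ∈ Finset.range N, annulusOpenCrossing (z i j) D'.δ (ρ + D'.δ) (16 * ρ - D'.δ) with hB
  have hsub : {ω | ∃ i ∈ s,
      (∀ j ≤ N, 44 * ρ ≤ infDist (z i j) (frontier Dm.carrier)) ∧
        ∀ j ≤ N, ∃ u, dist (medialExplorationCurve D' ω u) (z i j) < ρ} ⊆ ⋃ i ∈ s, B i := by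
    rintro ω ⟨i, hi, hfr, hvis⟩
    refine mem_iUnion₂.2 ⟨i, hi, ?_⟩
    have harms := arms_of_visits hadm Dm hΩ hδρ
      (fun j _ => hsep i hi (j + 1) j (Nat.succ_ne_self j)) hfr hvis
    exact mem_iInter₂.2 fun j hj => harms j (Finset.mem_range.1 hj)
  calc (bondPercolation (zdGraph 2) half).real {ω | ∃ i ∈ s,
          (∀ j ≤ N, 44 * ρ ≤ infDist (z i j) (frontier Dm.carrier)) ∧
            ∀ j ≤ N, ∃ u, dist (medialExplorationCurve D' ω u) (z i j) < ρ}
      ≤ (bondPercolation (zdGraph 2) half).real (⋃ i ∈ s, B i) :=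
        measureReal_mono hsub (measure_ne_top _ _)
    _ ≤ ∑ i ∈ s, (bondPercolation (zdGraph 2) half).real (B i) :=
        measureReal_biUnion_finset_le s B
    _ ≤ ∑ _i ∈ s, ((1 / 4 : ℝ) ^ α) ^ N :=
        Finset.sum_le_sum fun i hi =>
          real_biInter_annulusOpenCrossing_le hα hRSW hδ hδρ hc₀ (hsep i hi) N
    _ = s.card * ((1 / 4 : ℝ) ^ α) ^ N := by rw [Finset.sum_const, nsmul_eq_mul]

/-- **Family form: the interface class visiting a whole candidate chain is exponentially
unlikely.** For a `ℤ²`-discretisation family `E` of `D`, the RSW one-arm bound with exponent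
`α`, a scale `ρ > 0` and finitely many chains `z i`, `i ∈ s`, of pairwise `40ρ`-separated
points: for all small meshes `δ`, the probability that the interface class
`bondInterfaceIn D (E δ) ω` has its trace within `ρ` of every point `z i j`, `j ≤ N`, of some
chain all of whose points are at distance `≥ 44ρ` from `∂D`, is at most `|s| (4^{-α})^N`. -/
theorem eventually_measure_preimage_visits_le {ι : Type*} (D : DobrushinDomain)
    {E : ℝ → DiscreteDobrushin} (hE : ZdDiscretisationFamily D E) {α c₀ : ℝ} (hα : 0 < α)
    (hRSW : ∀ (x : ℂ) (δ r R : ℝ), 0 < δ → c₀ * δ ≤ r → 2 * r ≤ R →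
      (bondPercolation (zdGraph 2) half).real (annulusOpenCrossing x δ r R) ≤ (r / R) ^ α)
    {ρ : ℝ} (hρ : 0 < ρ) (s : Finset ι) {z : ι → ℕ → ℂ}
    (hsep : ∀ i ∈ s, ∀ j j', j ≠ j' → 40 * ρ ≤ dist (z i j) (z i j')) (N : ℕ) :
    ∀ᶠ δ in 𝓝[>] (0 : ℝ),
      bondPercolation (zdGraph 2) half (bondInterfaceIn D (E δ) ⁻¹' {γ | ∃ i ∈ s,
          (∀ j ≤ N, 44 * ρ ≤ infDist (z i j) (frontier D.carrier)) ∧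
            ∀ j ≤ N, infDist (z i j) γ.range < ρ}) ≤
        ENNReal.ofReal (s.card * ((1 / 4 : ℝ) ^ α) ^ N) := by
  have h1 := hE.eventually_isZdAdmissible
  have h2 : ∀ᶠ δ in 𝓝[>] (0 : ℝ), δ ≤ ρ := mem_nhdsWithin_of_mem_nhds (Iic_mem_nhds hρ)
  have h3 : ∀ᶠ δ in 𝓝[>] (0 : ℝ), c₀ * δ ≤ ρ := by
    have h : Tendsto (fun δ : ℝ => c₀ * δ) (𝓝 0) (𝓝 (c₀ * 0)) := tendsto_id.const_mul c₀
    rw [mul_zero] at h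
    exact mem_nhdsWithin_of_mem_nhds (h.eventually (Iic_mem_nhds hρ))
  filter_upwards [h1, h2, h3] with δ hadm hδρ hc₀δ
  have hδeq : (E δ).δ = δ := hE.δ_eq δ
  set P := bondPercolation (zdGraph 2) half with hP
  have hsub : bondInterfaceIn D (E δ) ⁻¹' {γ | ∃ i ∈ s,
      (∀ j ≤ N, 44 * ρ ≤ infDist (z i j) (frontier D.carrier)) ∧
        ∀ j ≤ N, infDist (z i j) γ.range < ρ} ⊆
      {ω | ∃ i ∈ s, (∀ j ≤ N, 44 * ρ ≤ infDist (z i j) (frontier D.carrier)) ∧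
        ∀ j ≤ N, ∃ u, dist (medialExplorationCurve (E δ) ω u) (z i j) < ρ} := by
    rintro ω ⟨i, hi, hfr, hnear⟩
    refine ⟨i, hi, hfr, fun j hj => ?_⟩
    have h := hnear j hj
    rw [range_bondInterfaceIn] at h
    obtain ⟨_, ⟨u, rfl⟩, hu⟩ := (infDist_lt_iff (Set.range_nonempty _)).1 h
    exact ⟨u, by rw [dist_comm]; exact hu⟩
  have hreal := real_setOf_visits_le hadm D (hE.Ω_eq δ) hα hRSW (by rw [hδeq]; exact hδρ)
    (by rw [hδeq]; exact hc₀δ) s hsep N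
  calc P (bondInterfaceIn D (E δ) ⁻¹' {γ | ∃ i ∈ s,
          (∀ j ≤ N, 44 * ρ ≤ infDist (z i j) (frontier D.carrier)) ∧
            ∀ j ≤ N, infDist (z i j) γ.range < ρ})
      ≤ P {ω | ∃ i ∈ s, (∀ j ≤ N, 44 * ρ ≤ infDist (z i j) (frontier D.carrier)) ∧
          ∀ j ≤ N, ∃ u, dist (medialExplorationCurve (E δ) ω u) (z i j) < ρ} := measure_mono hsub
    _ = ENNReal.ofReal (P.real {ω | ∃ i ∈ s,
          (∀ j ≤ N, 44 * ρ ≤ infDist (z i j) (frontier D.carrier)) ∧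
            ∀ j ≤ N, ∃ u, dist (medialExplorationCurve (E δ) ω u) (z i j) < ρ}) :=
        (ofReal_measureReal (measure_ne_top _ _)).symm
    _ ≤ ENNReal.ofReal (s.card * ((1 / 4 : ℝ) ^ α) ^ N) := ENNReal.ofReal_le_ofReal hreal

/-- **Registered sub-stub `stub_noSliding_visitsBound`** (line `hitting-tournament`, stub
`stub_quadTransfer_noSliding`, helper, part 1): `eventually_measure_preimage_visits_le` with
all arguments explicit. -/
theorem stub_noSliding_visitsBound : ∀ (ι : Type*) (D : DobrushinDomain) (E : ℝ → DiscreteDobrushin), ZdDiscretisationFamily D E → ∀ (α c₀ : ℝ), 0 < α → (∀ (x : ℂ) (δ r R : ℝ), 0 < δ → c₀ * δ ≤ r → 2 * r ≤ R → (bondPercolation (zdGraph 2) half).real (annulusOpenCrossing x δ r R) ≤ (r / R) ^ α) → ∀ (ρ : ℝ), 0 < ρ → ∀ (s : Finset ι) (z : ι → ℕ → ℂ), (∀ i ∈ s, ∀ j j' : ℕ, j ≠ j' → 40 * ρ ≤ dist (z i j) (z i j')) → ∀ (N : ℕ), ∀ᶠ δ in nhdsWithin (0 : ℝ) (Set.Ioi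 0), bondPercolation (zdGraph 2) half (bondInterfaceIn D (E δ) ⁻¹' {γ : CurveClass ℂ | ∃ i ∈ s, (∀ j ≤ N, 44 * ρ ≤ Metric.infDist (z i j) (frontier D.carrier)) ∧ ∀ j ≤ N, Metric.infDist (z i j) γ.range < ρ}) ≤ ENNReal.ofReal (s.card * ((1 / 4 : ℝ) ^ α) ^ N) :=
  fun _ D _ hE _ _ hα hRSW _ hρ s _ hsep N =>
    eventually_measure_preimage_visits_le D hE hα hRSW hρ s hsep N

end Summit.CriticalPhenomena.CardyFormulaZ2.Cruxes.LagHandOff.HittingTournament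

end
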